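import Mathlib
import Literature.Probability.Percolation.DiagonalStripGenericInversion
import HarnessLib

/-!
# One rapidity as a polynomial variable over the rapidity field

Topic `Literature/Probability/Percolation`. A small piece of infrastructure for degree/root counting
in ONE of the rapidities of the generic setting of `DiagonalStripGenericRapidities`
(`RapidityField K₀ = Frac K₀[X_0, X_1, …]`): the ring homomorphism
`rapUni i : K₀[X] → (RapidityField K₀)[T]` sending `X_i ↦ T` and `X_k ↦ C z_k` (`k ≠ i`).

* `eval_rapUni` — evaluating at `x` is the substitution `X_i ↦ x`; at `x = z_i` it is `toRF`
  (`eval_rapUni_genZ`), so `rapUni i` is injective;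
* `map_rapUni` — mapping the coefficients by a field endomorphism fixing the constants;
* `rapUni_monomial`, `natDegree_rapUni_le` — `deg_T ≤ deg_{X_i}`;
* `coeff_rapUni` — every coefficient is the image of an `X_i`-free polynomial.

Used for the root counting of the recursion scalar of Ikhlef–Ponsaing's eq. (25) in the variable
`z_1` (`DiagonalStripRecursionScalar`, `DiagonalStripSumInversion`).

## References

* Y. Ikhlef, A. K. Ponsaing, *Finite-size left-passage probability in percolation*, J. Stat. Phys.
  149 (2012) 10–36, arXiv:1202.5476, §3.6 (proof of Prop. 3.4: degree counting). [IkhlefPonsaing2012]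
-/

namespace Literature.Probability.Percolation

open MvPolynomial

section RapUni

variable (K₀ : Type*) [Field K₀]

/-- **`X_i ↦ T`, `X_k ↦ C z_k`**: one rapidity as a polynomial variable over the rapidity field.
[folklore] -/
noncomputable def rapUni (i : ℕ) : MvPolynomial ℕ K₀ →+* Polynomial (RapidityField K₀) :=
  eval₂Hom (Polynomial.C.comp ((toRF K₀).comp C))
    fun k => if k = i then Polynomial.X else Polynomial.C (genZ K₀ k)

variable {K₀}

/-- `rapUni` on constants. [folklore] -/
theorem rapUni_C (i : ℕ) (a : K₀) : rapUni K₀ i (C a) = Polynomial.C (genC K₀ a) := by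
  rw [rapUni, eval₂Hom_C]; rfl

/-- `rapUni` on its variable. [folklore] -/
theorem rapUni_X_self (i : ℕ) : rapUni K₀ i (X i) = Polynomial.X := by
  rw [rapUni, eval₂Hom_X', if_pos rfl]

/-- `rapUni` on the other variables. [folklore] -/
theorem rapUni_X_of_ne {i k : ℕ} (h : k ≠ i) : rapUni K₀ i (X k) = Polynomial.C (genZ K₀ k) := by
  rw [rapUni, eval₂Hom_X', if_neg h]

/-- **Evaluation at `x` is the substitution `X_i ↦ x`.** [folklore] -/
theorem eval_rapUni (i : ℕ) (x : RapidityField K₀) (F : MvPolynomial ℕ K₀) :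
    (rapUni K₀ i F).eval x = eval₂Hom ((toRF K₀).comp C) (Function.update (genZ K₀) i x) F := by
  have : (Polynomial.evalRingHom x).comp (rapUni K₀ i) = eval₂Hom ((toRF K₀).comp C) (Function.update (genZ K₀) i x) := by
    refine ringHom_ext (fun a => ?_) (fun k => ?_)
    · rw [RingHom.comp_apply, rapUni_C, Polynomial.coe_evalRingHom, Polynomial.eval_C, eval₂Hom_C]; rfl
    · rw [RingHom.comp_apply, Polynomial.coe_evalRingHom, eval₂Hom_X', Function.update_apply]
      by_cases hk : k = i
      · subst hk; rw [rapUni_X_self, Polynomial.eval_X, if_pos rfl]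
      · rw [rapUni_X_of_ne hk, Polynomial.eval_C, if_neg hk]
  exact RingHom.congr_fun this F

/-- At `x = z_i` the evaluation is the embedding `toRF`. [folklore] -/
theorem eval_rapUni_genZ (i : ℕ) (F : MvPolynomial ℕ K₀) : (rapUni K₀ i F).eval (genZ K₀ i) = toRF K₀ F := by
  rw [eval_rapUni, Function.update_eq_self, ← toRF_eq_eval₂Hom]

/-- `rapUni` is injective. [folklore] -/
theorem rapUni_injective (i : ℕ) : Function.Injective (rapUni K₀ i) := fun F G h => by
  apply toRF_injective
  rw [← eval_rapUni_genZ i F, ← eval_rapUni_genZ i G, h]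

/-- **Mapping the coefficients** by a ring endomorphism of the rapidity field fixing the constants.
[folklore] -/
theorem map_rapUni (i : ℕ) (φ : RapidityField K₀ →+* RapidityField K₀) (hφ : ∀ a, φ (genC K₀ a) = genC K₀ a)
    (F : MvPolynomial ℕ K₀) :
    (rapUni K₀ i F).map φ = eval₂Hom (Polynomial.C.comp ((toRF K₀).comp C))
      (fun k => if k = i then Polynomial.X else Polynomial.C (φ (genZ K₀ k))) F := by
  have : (Polynomial.mapRingHom φ).comp (rapUni K₀ i) = eval₂Hom (Polynomial.C.comp ((toRF K₀).comp C))
      (fun k => if k = i then Polynomial.X else Polynomial.C (φ (genZ K₀ k))) := by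
    refine ringHom_ext (fun a => ?_) (fun k => ?_)
    · rw [RingHom.comp_apply, rapUni_C, Polynomial.coe_mapRingHom, Polynomial.map_C, hφ, eval₂Hom_C]; rfl
    · rw [RingHom.comp_apply, Polynomial.coe_mapRingHom, eval₂Hom_X']
      by_cases hk : k = i
      · subst hk; rw [rapUni_X_self, Polynomial.map_X, if_pos rfl]
      · rw [rapUni_X_of_ne hk, Polynomial.map_C, if_neg hk]
  exact RingHom.congr_fun this F

/-- `toRF` of a monomial. [folklore] -/
theorem toRF_monomial (s : ℕ →₀ ℕ) (a : K₀) :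
    toRF K₀ (monomial s a) = genC K₀ a * s.prod fun k e => genZ K₀ k ^ e := by
  rw [toRF_eq_eval₂Hom, eval₂Hom_monomial]; rfl

/-- **`rapUni` of a monomial**: `C (toRF (the monomial without X_i)) · T^{s i}`. [folklore] -/
theorem rapUni_monomial (i : ℕ) (s : ℕ →₀ ℕ) (a : K₀) :
    rapUni K₀ i (monomial s a) = Polynomial.C (toRF K₀ (monomial (s.erase i) a)) * Polynomial.X ^ (s i) := by
  classical
  rw [rapUni, eval₂Hom_monomial, toRF_monomial, map_mul, mul_assoc]
  congr 1
  -- split the product at `i`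
  have hs : s.support ⊆ insert i s.support := Finset.subset_insert _ _
  have hs' : (s.erase i).support ⊆ insert i s.support := by
    rw [Finsupp.support_erase]; exact (Finset.erase_subset _ _).trans hs
  rw [Finsupp.prod_of_support_subset s hs _ (fun k _ => pow_zero _),
    Finsupp.prod_of_support_subset _ hs' _ (fun k _ => pow_zero _),
    ← Finset.mul_prod_erase _ _ (Finset.mem_insert_self i s.support),
    ← Finset.mul_prod_erase _ _ (Finset.mem_insert_self i s.support), if_pos rfl, Finsupp.erase_same, pow_zero,
    one_mul, map_prod, mul_comm]
  congr 1
  refine Finset.prod_congr rfl fun k hk => ?_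
  have hki : k ≠ i := (Finset.mem_erase.1 hk).1
  rw [if_neg hki, Finsupp.erase_ne hki, map_pow]

/-- **`deg_T (rapUni i F) ≤ deg_{X_i} F`.** [folklore] -/
theorem natDegree_rapUni_le (i : ℕ) (F : MvPolynomial ℕ K₀) : (rapUni K₀ i F).natDegree ≤ F.degreeOf i := by
  classical
  conv_lhs => rw [F.as_sum, map_sum]
  refine Polynomial.natDegree_sum_le_of_forall_le _ _ fun s hs => ?_
  rw [rapUni_monomial]
  exact (Polynomial.natDegree_C_mul_X_pow_le _ _).trans (monomial_le_degreeOf i hs)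

/-- **Every coefficient of `rapUni i F` is the image of an `X_i`-free polynomial.** [folklore] -/
theorem coeff_rapUni (i : ℕ) (F : MvPolynomial ℕ K₀) (d : ℕ) :
    ∃ c : MvPolynomial ℕ K₀, c.degreeOf i = 0 ∧ (rapUni K₀ i F).coeff d = toRF K₀ c := by
  classical
  refine ⟨∑ s ∈ F.support.filter (fun s => s i = d), monomial (s.erase i) (coeff s F), ?_, ?_⟩
  · apply Nat.eq_zero_of_le_zero
    refine (degreeOf_sum_le i _ _).trans (Finset.sup_le fun s _ => ?_)
    by_cases h0 : coeff s F = 0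
    · rw [h0, monomial_zero, degreeOf_zero]
    · rw [degreeOf_monomial_eq _ _ h0, Finsupp.erase_same]
  · conv_lhs => rw [F.as_sum, map_sum]
    rw [Polynomial.finsetSum_coeff, map_sum, Finset.sum_filter]
    refine Finset.sum_congr rfl fun s _ => ?_
    rw [rapUni_monomial, Polynomial.coeff_C_mul_X_pow]
    by_cases h : s i = d
    · rw [if_pos h.symm, if_pos h]
    · rw [if_neg (fun h' => h h'.symm), if_neg h]

/-- Hence the leading coefficient, too. [folklore] -/
theorem leadingCoeff_rapUni (i : ℕ) (F : MvPolynomial ℕ K₀) :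
    ∃ c : MvPolynomial ℕ K₀, c.degreeOf i = 0 ∧ (rapUni K₀ i F).leadingCoeff = toRF K₀ c :=
  coeff_rapUni i F _

end RapUni

end Literature.Probability.Percolation
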